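/-
Copyright: statement-level skeleton of a published paper (lit-balaban cell, Phase-2 proof seat p13, gen 12). No proof
claims beyond what the kernel checks below.
-/
import Literature.MathematicalPhysics.QuantumFieldTheory.BalabanImbrieJaffe1984to88.BIJ88WickSource305

/-!
# `BalabanImbrieJaffe1984to88.BIJ88WickSourceSmooth305` — T. Bałaban, J. Imbrie, A. Jaffe, *Effective action and cluster
properties of the abelian Higgs model*, Commun. Math. Phys. **114** (1988) 257–315 [BalabanImbrieJaffe1988], §5.13
p. 305–306 [PDF 49–50]: **"Each Φ contracts through a C_s to another Φ, to an f(□_i) or to ℱ"** — THE COMPLETE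
CONTRACTION OF A MONOMIAL IN THE FIELDS AGAINST A SMOOTH FACTOR `H` (the `f(□_i)`), at every degree: Wick's theorem with
linear term AND derivatives, the every-degree form of p13 g6 `BIJ88IntegrationByParts305.ibp_fields` (one field) and of
`BIJ88TruncatedPair306.pair_contraction` (two fields); `BIJ88WickSource305.wick_source` is the case `H = 1`.

For `A` positive definite (`C = A⁻¹ = C_s`), `dμ = e^{−½⟨Φ,AΦ⟩}e^{⟨ℱ,Φ⟩}dΦ`, vectors `v_i` indexed by a linearly ordered
finite set `T`, and `H` in a class `𝒞` of `C¹_b` functions closed under directional derivatives: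

  `∫ Π_{i∈T}Φ(v_i)·H dμ = Σ_{D ⊆ T} ( Σ_{σ ∈ smallParts(T∖D)} Π_{B∈σ} w_B ) · ∫ ∂_{Cv_D}H dμ`     (`wick_source_smooth`)

— the fields in `D` contract *"to an f(□_i)"* (a derivative `∂_{Cv_i}` on `H`; `∂_{Cv_D}` = `dset`, the iterated
directional derivative along `Cv_i`, `i ∈ D`, inner derivatives at larger indices), the others pair up
(`w_{{i,j}} = ⟨Cv_i,v_j⟩`, *"to another Φ"*) or go to the linear term (`w_{{i}} = ⟨Cv_i,ℱ⟩`, *"or to ℱ"*)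
(`BIJ88WickSource305.cweight`).  PROOF: strong induction on `T`, integrating the LARGEST field by parts (`ibp_fields`),
the induction hypothesis for `H` and for `∂_{Cv_j}H`, and the small-partition recursion
`BIJ88PairingAllOrders5133.sum_smallParts_insert`.

This is the input named in the gen-12 HANDOFF for the every-order walk form of (5.13.3) (joint truncations of the two-leg
block vertices `V_B = ΦᵀM_BΦ` against `H`: expand each vertex in coordinate pairs, contract completely, truncate).

statement-level skeleton of published theorems with citation tags; proofs where landed; nothing here is a claim
about the Yang–Mills mass gap

PDF held: `paper:balaban1988-cmp114-bij-abelian-higgs-effective-action` (journal page = PDF page + 256).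

CITATION HEADER (lean-in-tree rule).  lit-balaban cell (HOME `run/shared/lean/pub/lit-balaban/`), Phase 2, seat p13
gen 12; row **C2.Eq5.13.3-5.13.4** of `HOME/lit-balaban-r16/ROWS-C2-part2.md` (owner r16, referee ref-5), second clause
of the flip condition.  USED BY NAME, nothing restated: p13 g6 `BIJ88IntegrationByParts305.ibp_fields`; p13 g12
`BIJ88WickSource305.{cweight, cweight_singleton, cweight_pair, inv_dotProduct_comm}`,
`BIJ88PairingAllOrders5133.{smallParts, smallParts_empty, mem_smallParts, sum_smallParts_insert}`.

## What is proved (0 `sorry`, standard axioms, no new `Prop` facts)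

* `dset` (iterated directional derivative over a finite ordered index set), `dset_empty`, `dset_insert_max`;
* **`wick_source_smooth`** — the theorem, for every `H` in a class `𝒞 ⊆ C¹_b` closed under directional derivatives
  (hypotheses `hC`, `hD`; e.g. smooth functions with all derivatives bounded).
HONEST SCOPE.  Finite-dimensional real Gaussian with linear term.  NOT summit progress; NOT continuum; NOT Clay.
Imports `BIJ88WickSource305`; modifies nothing.
-/

noncomputable section

namespace Literature.MathematicalPhysics.QuantumFieldTheory.BalabanImbrieJaffe1984to88.BIJ88WickSourceSmooth305

open MeasureTheory Matrix Finset Function Filter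
open scoped BigOperators Topology
open Literature.MathematicalPhysics.QuantumFieldTheory.Balaban1983to89
open B2Eq228Conditioning (weight source)
open BIJ88IntegrationByParts305 (ibp_fields)
open BIJ88PairingAllOrders5133 (smallParts smallParts_empty mem_smallParts sum_smallParts_insert)
open BIJ88WickSource305 (cweight cweight_singleton cweight_pair inv_dotProduct_comm)

variable {S : Type} [Fintype S] [DecidableEq S] {κ : Type} [LinearOrder κ]

/-- **Iterated directional derivative over a finite ordered set of directions**: `∂_{u_D}H`, the derivative along `u_j`
for the largest `j ∈ D` taken first (innermost), then recursively over `D ∖ {j}`. [cite: BalabanImbrieJaffe1988, §5.13 p.305–306] -/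
def dset (u : κ → S → ℝ) (D : Finset κ) (H : (S → ℝ) → ℝ) : (S → ℝ) → ℝ :=
  if h : D.Nonempty then dset u (D.erase (D.max' h)) (fun φ => fderiv ℝ H φ (u (D.max' h))) else H
termination_by D.card
decreasing_by exact card_erase_lt_of_mem (max'_mem D h)

omit [Fintype S] [DecidableEq S] in
/-- No direction: `∂_∅H = H`. [cite: BalabanImbrieJaffe1988, §5.13 p.305–306] -/
theorem dset_empty (u : κ → S → ℝ) (H : (S → ℝ) → ℝ) : dset u ∅ H = H := by
  rw [dset]
  simp

omit [Fintype S] [DecidableEq S] in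
/-- Adding a direction above all others: `∂_{u_{D∪{j}}}H = ∂_{u_D}(∂_{u_j}H)` (`j > D`).
[cite: BalabanImbrieJaffe1988, §5.13 p.305–306] -/
theorem dset_insert_max (u : κ → S → ℝ) {D : Finset κ} {j : κ} (hj : ∀ x ∈ D, x < j) (H : (S → ℝ) → ℝ) :
    dset u (insert j D) H = dset u D (fun φ => fderiv ℝ H φ (u j)) := by
  have hne : (insert j D).Nonempty := insert_nonempty j D
  have hmax : (insert j D).max' hne = j := by
    refine le_antisymm (max'_le _ hne _ fun x hx => ?_) (le_max' _ _ (mem_insert_self j D))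
    rcases mem_insert.1 hx with rfl | hx
    · exact le_rfl
    · exact (hj x hx).le
  have hjD : j ∉ D := fun h => lt_irrefl j (hj j h)
  rw [dset, dif_pos hne]
  simp only [hmax, erase_insert hjD]

/-- **WICK'S THEOREM WITH LINEAR TERM AND A SMOOTH FACTOR** — *"Each Φ contracts through a C_s to another Φ, to an f(□_i)
or to ℱ"* at every degree: for `H` in a class `𝒞` of `C¹_b` functions closed under directional derivatives,
`∫ Π_{i∈T}Φ(v_i)·H dμ = Σ_{D⊆T} (Σ_{σ∈smallParts(T∖D)} Π_{B∈σ}w_B) · ∫ ∂_{Cv_D}H dμ`.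
[cite: BalabanImbrieJaffe1988, §5.13 p.305–306] -/
theorem wick_source_smooth (A : Matrix S S ℝ) (hA : A.PosDef) (f : S → ℝ) (v : κ → S → ℝ)
    (𝒞 : ((S → ℝ) → ℝ) → Prop)
    (hC : ∀ G, 𝒞 G → ContDiff ℝ 1 G ∧ (∃ K₀ : ℝ, ∀ φ, ‖G φ‖ ≤ K₀) ∧ ∃ K₁ : ℝ, ∀ φ, ‖fderiv ℝ G φ‖ ≤ K₁)
    (hD : ∀ G (u : S → ℝ), 𝒞 G → 𝒞 (fun φ => fderiv ℝ G φ u)) (T : Finset κ) :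
    ∀ H : (S → ℝ) → ℝ, 𝒞 H →
      ∫ φ : S → ℝ, (∏ i ∈ T, φ ⬝ᵥ v i) * H φ * (weight A φ * source f φ)
        = ∑ D ∈ T.powerset, (∑ σ ∈ smallParts (T \ D), ∏ B ∈ σ, cweight A f v B)
            * ∫ φ : S → ℝ, dset (fun i => A⁻¹ *ᵥ v i) D H φ * (weight A φ * source f φ) := by
  induction T using Finset.strongInduction with
  | H T ih =>
    intro H hH
    rcases T.eq_empty_or_nonempty with hT | hne
    · subst hT
      simp [smallParts_empty, dset_empty]
    · -- integrate the largest field by parts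
      set j : κ := T.max' hne with hjdef
      have hj : j ∈ T := max'_mem T hne
      have hj' : j ∉ T.erase j := notMem_erase j T
      have hsub : T.erase j ⊂ T := erase_ssubset hj
      have hlt : ∀ x ∈ T.erase j, x < j := fun x hx => by
        obtain ⟨hxj, hxT⟩ := mem_erase.1 hx
        exact lt_of_le_of_ne (le_max' T x hxT) hxj
      obtain ⟨hH1, ⟨K₀, h0⟩, ⟨K₁, h1⟩⟩ := hC H hH
      have hibp := ibp_fields A hA f (T.erase j) v hH1 h0 h1 (v j)
      have e : ∫ φ : S → ℝ, (∏ i ∈ T, φ ⬝ᵥ v i) * H φ * (weight A φ * source f φ)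
          = ∫ φ : S → ℝ, (φ ⬝ᵥ v j) * ((∏ i ∈ T.erase j, φ ⬝ᵥ v i) * H φ) * (weight A φ * source f φ) := by
        congr 1
        funext φ
        rw [← Finset.mul_prod_erase T (fun i => φ ⬝ᵥ v i) hj]
        ring
      rw [e, hibp]
      -- induction hypotheses
      have ih2 := ih _ hsub (fun φ => fderiv ℝ H φ (A⁻¹ *ᵥ v j)) (hD H _ hH)
      beta_reduce at ih2
      rw [ih _ hsub H hH, ih2, sum_congr rfl fun i hi => by rw [ih _ ((erase_ssubset hi).trans hsub) H hH]]
      -- the right-hand side over `T = insert j (T.erase j)`: split `D ∌ j` / `D ∋ j`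
      have hT : insert j (T.erase j) = T := insert_erase hj
      conv_rhs => rw [← hT, powerset_insert]
      have hdisj : Disjoint (T.erase j).powerset ((T.erase j).powerset.image (insert j)) := by
        rw [disjoint_left]
        intro D hD1 hD2
        obtain ⟨D', -, hD'⟩ := mem_image.1 hD2
        have : j ∈ D := hD' ▸ mem_insert_self j D'
        exact hj' (mem_powerset.1 hD1 this)
      have hinj : Set.InjOn (insert j) ((T.erase j).powerset : Set (Finset κ)) := by
        intro D hD D' hD' h
        have h1 : j ∉ D := fun hjD => hj' (mem_powerset.1 (mem_coe.1 hD) hjD)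
        have h2 : j ∉ D' := fun hjD => hj' (mem_powerset.1 (mem_coe.1 hD') hjD)
        rw [← erase_insert h1, h, erase_insert h2]
      rw [sum_union hdisj, sum_image hinj]
      -- `D ∌ j`: the new field is alone (ℱ) or paired with an old one
      have hpart1 : ∀ D ∈ (T.erase j).powerset,
          (∑ σ ∈ smallParts (insert j (T.erase j) \ D), ∏ B ∈ σ, cweight A f v B)
            = (A⁻¹ *ᵥ v j) ⬝ᵥ f * (∑ σ ∈ smallParts (T.erase j \ D), ∏ B ∈ σ, cweight A f v B)
              + ∑ i ∈ T.erase j \ D, (A⁻¹ *ᵥ v j) ⬝ᵥ v i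
                * ∑ σ ∈ smallParts ((T.erase j \ D).erase i), ∏ B ∈ σ, cweight A f v B := by
        intro D hD
        have hjD : j ∉ T.erase j \ D := fun h => hj' (mem_sdiff.1 h).1
        have hDj : j ∉ D := fun hjD' => hj' (mem_powerset.1 hD hjD')
        rw [insert_sdiff_of_notMem (T.erase j) hDj, sum_smallParts_insert hjD]
        congr 1
        · rw [mul_sum]
          refine sum_congr rfl fun σ hσ => ?_
          have hP := (mem_smallParts.1 hσ).1
          have hjσ : ({j} : Finset κ) ∉ σ := fun h => hjD (hP.subset h (mem_singleton_self j))
          rw [prod_insert hjσ, cweight_singleton]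
        · refine sum_congr rfl fun i hi => ?_
          rw [mul_sum]
          refine sum_congr rfl fun σ hσ => ?_
          have hP := (mem_smallParts.1 hσ).1
          have hij : i ≠ j := fun e => hjD (e ▸ hi)
          have hijσ : ({i, j} : Finset κ) ∉ σ := fun h =>
            (notMem_erase i (T.erase j \ D)) (hP.subset h (mem_insert_self i {j}))
          rw [prod_insert hijσ, cweight_pair hA f v hij, inv_dotProduct_comm hA (v i) (v j)]
      -- `D ∋ j`: the new field differentiates `H`
      have hpart2 : ∀ D ∈ (T.erase j).powerset,
          (∑ σ ∈ smallParts (insert j (T.erase j) \ insert j D), ∏ B ∈ σ, cweight A f v B)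
              * ∫ φ : S → ℝ, dset (fun i => A⁻¹ *ᵥ v i) (insert j D) H φ * (weight A φ * source f φ)
            = (∑ σ ∈ smallParts (T.erase j \ D), ∏ B ∈ σ, cweight A f v B)
              * ∫ φ : S → ℝ, dset (fun i => A⁻¹ *ᵥ v i) D (fun ψ => fderiv ℝ H ψ (A⁻¹ *ᵥ v j)) φ
                  * (weight A φ * source f φ) := by
        intro D hD
        have hDsub : D ⊆ T.erase j := mem_powerset.1 hD
        rw [insert_sdiff_insert, sdiff_insert_of_notMem hj',
          dset_insert_max (fun i => A⁻¹ *ᵥ v i) (fun x hx => hlt x (hDsub hx)) H]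
      -- bookkeeping: exchange the double sum `Σ_i Σ_{D ⊆ T'∖i}` ↔ `Σ_D Σ_{i ∈ T'∖D}`
      have hcomm : ∑ i ∈ T.erase j, (A⁻¹ *ᵥ v j) ⬝ᵥ v i *
            ∑ D ∈ ((T.erase j).erase i).powerset,
              (∑ σ ∈ smallParts ((T.erase j).erase i \ D), ∏ B ∈ σ, cweight A f v B)
                * ∫ φ : S → ℝ, dset (fun i => A⁻¹ *ᵥ v i) D H φ * (weight A φ * source f φ)
          = ∑ D ∈ (T.erase j).powerset, ∑ i ∈ T.erase j \ D, (A⁻¹ *ᵥ v j) ⬝ᵥ v i *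
              ((∑ σ ∈ smallParts ((T.erase j \ D).erase i), ∏ B ∈ σ, cweight A f v B)
                * ∫ φ : S → ℝ, dset (fun i => A⁻¹ *ᵥ v i) D H φ * (weight A φ * source f φ)) := by
        simp_rw [mul_sum, erase_sdiff_comm]
        refine sum_comm' fun i D => ?_
        simp only [mem_powerset, Finset.mem_sdiff, mem_erase, subset_erase]
        tauto
      rw [hcomm]
      -- collect everything under one sum over `D ⊆ T.erase j`
      conv_lhs => rw [mul_sum]
      rw [← sum_add_distrib, ← sum_add_distrib, ← sum_add_distrib]
      refine sum_congr rfl fun D hD => ?_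
      rw [hpart1 D hD, hpart2 D hD]
      have hx : (∑ i ∈ T.erase j \ D, (A⁻¹ *ᵥ v j) ⬝ᵥ v i
              * ∑ σ ∈ smallParts ((T.erase j \ D).erase i), ∏ B ∈ σ, cweight A f v B)
            * ∫ φ : S → ℝ, dset (fun i => A⁻¹ *ᵥ v i) D H φ * (weight A φ * source f φ)
          = ∑ i ∈ T.erase j \ D, (A⁻¹ *ᵥ v j) ⬝ᵥ v i
              * ((∑ σ ∈ smallParts ((T.erase j \ D).erase i), ∏ B ∈ σ, cweight A f v B)
                * ∫ φ : S → ℝ, dset (fun i => A⁻¹ *ᵥ v i) D H φ * (weight A φ * source f φ)) := by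
        rw [sum_mul]
        exact sum_congr rfl fun _ _ => mul_assoc _ _ _
      rw [add_mul, hx]
      ring

end Literature.MathematicalPhysics.QuantumFieldTheory.BalabanImbrieJaffe1984to88.BIJ88WickSourceSmooth305
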